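import Mathlib
import HarnessLib
import Summits.HubbardSuperconductivity.HubbardSuperconductivity.Theorems.KLProgrammeKLRegimeEngineFrameShiftDressingSupFlowMainAliasGraded
import Summits.HubbardSuperconductivity.HubbardSuperconductivity.Theorems.KLProgrammeKLRegimeEngineLastRespMomentsOfPosition
import Summits.HubbardSuperconductivity.HubbardSuperconductivity.Theorems.KLProgrammeKLRegimeEngineFrameShiftDressingSupFlowMainAliasPos
import Summits.HubbardSuperconductivity.HubbardSuperconductivity.Theorems.KLProgrammeKLRegimeEngineFrameShiftDressingSupFlowMainAliasGradedPure
import Summits.HubbardSuperconductivity.HubbardSuperconductivity.Theorems.KLProgrammeKLRegimeEngineFrameShiftDressingSupFlowMainAliasPosPure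
import Summits.HubbardSuperconductivity.HubbardSuperconductivity.Theorems.KLProgrammePlainRowsUVCutBridge

/-!
# K3 gen-8-FLOW (stmt 20437 `KLRegimeEngineV17F2`, stub (C), ROW (C) binder #2 `hres‴` row `cN m 0`): cure (α) of located #25 «(b)-PLAIN-UV-TAIL», LINK 5a (the read
# site) — THE GENERAL-STEP (B) DOOR AT `Md = 38` WITH ITS FOUR-LEG KERNEL INPUT `hNp` STATED FOR THE UV-CUT ELEMENT
# (cell gate-hubbard-kl, seat hubbard-kl-k3c2-p2 g34; twin of ✓ `…FrameShiftDressingSupFlowMainAliasPosPure.…_pos_pure` (p2 g22); pen (R669)/(R670)/(R673): located #25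
# of record ×3, hit set {#2 `cN m 0`, #5, #6}, cure (α) of record, build authorised, lead k3c2-p2)

WHAT CHANGES vs `…_main_add_alias_pos_pure` (everything else token-identical — the two-leg rows `hSp/hSEp`, envelopes, regime, `FrameOK` ×2, `fd`, `hZ₂/hZ`, `hq₁/hq₂`,
the flow history, the closed envelopes + door, `klEngL₄ ≤ L`, `m ≤ n_β+1`, `30 ≤ s`, `j ≤ 4` and the CONCLUSION): the tower input `hNp` — the pinned, spatially
weighted `L¹` norm of the FOUR-leg position kernel of the interpolated action `𝒢_t` — is stated for the leg-rescaled element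
`S_ĝ 𝒢_t := ExteriorAlgebra.map (LinearMap.mulLeft ℂ ĝ) 𝒢_t`, `ĝ((k,σ),c) = gnScaleCutoff 4 klE0 1 |ω_k|` (smooth one-sector UV cut in the frequency, `≡ 1` for
`|ω| ≤ klE0`).  WHY (located #25, ✓ p765343 / p765762 / p766222): the tree's `hubbardInteraction` conserves the INTEGER Matsubara labels, so the uncut plain position-space
quartic line of `𝒢_t` carries the bare vertex's integer-truncation tail `(|U|/24)·Θ_M`, `Θ_M ≍ (ln M)²`, and binder #2's row `cN m 0` (capped M-free through
`X m 0 → cc′ → klC4aJetC′`) is unsatisfiable as typed; the cut line is M-uniform.  WHY NOTHING IS LOST: the door reads the quartic kernel ONLY at the strings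
`(((i,k⃗),σ),0), (((i,k⃗),σ),1), (A.1, 1−A.2), A` with the external frequency `i ∈ {ω₀, −ω₀}` (`|ω₀| = π/β ≤ π/128 < klE0`) and the loop frequency
`|ω_A| < Λ_m ≤ klE0` (hypothesis of the graded-pure door), where every leg's cut factor is `1`:
* `klbv_kernel_four_readingString_uvCut` — at such strings `kernel (S_ĝ W) 4 X = kernel W 4 X` (`kernel_map_mulLeft`, `gnScaleCutoff_eq_one`), for ANY `W`;
* **`norm_iteratedFDeriv_klLocSelfEnergyRe_flowFrame_sub_le_main_add_alias_pos_pure_cut`** — same binders but `hNp` on `S_ĝ 𝒢_t`, SAME conclusion; proof = the original's,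
  the four-leg tower input `N` being read off the cut line through `TwoLegFourier.sum_weight_mul_norm_torusFourierInv_kernel_four_le` (generic in the element) after
  the string identity.
Composition only; no definitions; the rows stay hypotheses; nothing asserts (C), any stub of 20437, K3, U₀, the window or superconductivity.
References: BGM 2006 §2.1 (2.4)–(2.5), §2.3 (2.17)–(2.24), §2.5 (2.48) [cite: BenfattoGiulianiMastropietro2006]; Salmhofer 1999 §4.2.5.
-/

noncomputable section

namespace Summit.HubbardSuperconductivity.HubbardSuperconductivity.Theorems.EngineV8

set_option linter.dupNamespace false -- summit = problem name (single-conjunct summit), D-0017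

open Real Finset Filter Literature.MathematicalPhysics.QuantumLattice Literature.Probability.LatticeModels GrassmannAlgebra
open Summit.HubbardSuperconductivity.HubbardSuperconductivity.Theorems.KLRegimeSplit
open Summit.HubbardSuperconductivity.HubbardSuperconductivity.Theorems.DispersionFlow
open Summit.HubbardSuperconductivity.HubbardSuperconductivity.Theorems.KLProgrammeLegKernels
open scoped Nat

variable {L M : ℕ} [NeZero L] [NeZero M]

omit [NeZero L] in
/-- **At the reading strings the UV cut is invisible**: for the external frequency `i ∈ {ω₀, −ω₀}` (`β ≥ klBetaMin`, so `|ω₀| = π/β ≤ klE0`) and a loop leg `Al` with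
`|ω_{Al}| < Λ_m ≤ klE0`, every leg of the string `(((i,k⃗),σ),0), (((i,k⃗),σ),1), (Al.1, 1 − Al.2), Al` has cut factor `ĝ = 1`, hence
`kernel (S_ĝ W) 4 X = kernel W 4 X` for ANY Grassmann element `W` (`kernel_map_mulLeft`, `gnScaleCutoff_eq_one`). [cite: BenfattoGiulianiMastropietro2006, §2.5 (2.48)] -/
theorem klbv_kernel_four_readingString_uvCut {β : ℝ} (hβmin : klBetaMin ≤ β) (W : HubbardGrassmann L M) (m : ℕ) {i : MatsubaraIdx M}
    (hi : i ∈ ({omega0 M, (omega0 M).rev} : Finset (MatsubaraIdx M))) (σ : Fin 2) {Al : HubbardFieldIdx L M}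
    (hAl : |matsubaraFreq β M Al.1.1.1| < klScale klE0 m) (kv : TorusSite 2 L) :
    kernel ℂ (ExteriorAlgebra.map (LinearMap.mulLeft ℂ (fun K : HubbardFieldIdx L M => ((gnScaleCutoff 4 klE0 1 |matsubaraFreq β M K.1.1.1| : ℝ) : ℂ))) W) 4
        (Fin.snoc (Fin.snoc ![((((i, kv), σ), 0) : HubbardFieldIdx L M), (((i, kv), σ), 1)] (Al.1, 1 - Al.2) : Fin 3 → HubbardFieldIdx L M) Al) =
      kernel ℂ W 4 (Fin.snoc (Fin.snoc ![((((i, kv), σ), 0) : HubbardFieldIdx L M), (((i, kv), σ), 1)] (Al.1, 1 - Al.2) : Fin 3 → HubbardFieldIdx L M) Al) := by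
  have hβ0 : 0 < β := KLRegimeSplit.pos_of_klBetaMin_le hβmin
  have he : (0 : ℝ) < klE0 := by norm_num [klE0]
  have h4 : (1 : ℝ) < 4 := by norm_num
  have hcut1 : ∀ K' : HubbardFieldIdx L M, |matsubaraFreq β M K'.1.1.1| ≤ klE0 →
      (fun K : HubbardFieldIdx L M => ((gnScaleCutoff 4 klE0 1 |matsubaraFreq β M K.1.1.1| : ℝ) : ℂ)) K' = 1 := by
    intro K' hK'
    show ((gnScaleCutoff 4 klE0 1 |matsubaraFreq β M K'.1.1.1| : ℝ) : ℂ) = 1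
    rw [gnScaleCutoff_eq_one h4 he (by rwa [sub_self, zpow_zero, mul_one]), Complex.ofReal_one]
  -- the external frequency: `|±ω₀| = π/β ≤ π/128 ≤ 1/32 = klE0`
  have hπ : Real.pi / β ≤ klE0 := by
    have h128 : (128 : ℝ) ≤ β := by unfold klBetaMin at hβmin; exact hβmin
    rw [div_le_iff₀ hβ0]
    unfold klE0
    nlinarith [Real.pi_le_four]
  have hiE : |matsubaraFreq β M i| ≤ klE0 := by
    simp only [Finset.mem_insert, Finset.mem_singleton] at hi
    rcases hi with rfl | rfl
    · rw [matsubaraFreq_omega0, abs_of_pos (div_pos Real.pi_pos hβ0)]; exact hπ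
    · rw [matsubaraFreq_omega0_rev, abs_neg, abs_of_pos (div_pos Real.pi_pos hβ0)]; exact hπ
  -- the loop frequency: `|ω_{Al}| < Λ_m = klE0·4^{-m} ≤ klE0`
  have hΛ : klScale klE0 m ≤ klE0 := by
    unfold klScale
    exact mul_le_of_le_one_right he.le (inv_le_one_of_one_le₀ (one_le_pow₀ (by norm_num)))
  have hAlE : |matsubaraFreq β M Al.1.1.1| ≤ klE0 := hAl.le.trans hΛ
  have hlegs : ∀ leg : Fin 4,
      |matsubaraFreq β M ((Fin.snoc (Fin.snoc ![((((i, kv), σ), 0) : HubbardFieldIdx L M), (((i, kv), σ), 1)] (Al.1, 1 - Al.2) :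
        Fin 3 → HubbardFieldIdx L M) Al : Fin 4 → HubbardFieldIdx L M) leg).1.1.1| ≤ klE0 := by
    intro leg
    fin_cases leg
    · exact hiE
    · exact hiE
    · exact hAlE
    · exact hAlE
  rw [kernel_map_mulLeft, Finset.prod_eq_one (fun leg _ => hcut1 _ (hlegs leg)), one_mul]

section MainAliasPos

/-- **THE GENERAL-STEP (B) DOOR AT `Md = 38` WITH ITS KERNEL INPUTS IN POSITION SPACE, THE FOUR-LEG INPUT ON THE UV-CUT ELEMENT** — see the module docstring. [cite: BenfattoGiulianiMastropietro2006, §2.3 (2.21)–(2.24)] -/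
theorem norm_iteratedFDeriv_klLocSelfEnergyRe_flowFrame_sub_le_main_add_alias_pos_pure_cut {β : ℝ} (hβmin : klBetaMin ≤ β) {U : ℝ} (hU : 0 < U) (hU1 : U ≤ 1) (μ : ℝ) (m : ℕ)
    {G : GeoConsts} {Q : EngConsts} {R : RenConsts} (hRG : ∀ j, 0 ≤ R.Gfr j) (hGS : ∀ k, 0 ≤ G.S k) (hQS : ∀ k, 0 ≤ Q.S' k) (hμ : μ ∈ klWindowC)
    {Nf₁ Nf₂ : ℕ} (hOK₁ : FrameOK R U Nf₁ μ (klFlowFrameU L M β U μ m)) (hOK₂ : FrameOK R U Nf₂ μ (klFlowFrameU L M β U μ (m + 1)))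
    {fd : ℝ} (hfdist : frameDist (klFlowFrameU L M β U μ (m + 1)) (klFlowFrameU L M β U μ m) ≤ fd) (hfd : fd ≤ (klScale klE0 m) / 4)
    (hZ₂ : IsUnit (effPartitionFn ℂ (normalCovariance L M (uvSymbolCT L M β μ (klFlowFrameU L M β U μ (m + 1)) (klScale klE0 m))) (hubbardInteraction L M β U + counterQuadratic L M β (klFlowFrameU L M β U μ (m + 1)))))
    (hZ : ∀ t ∈ Set.Icc (0 : ℝ) 1, effPartitionFn ℂ
      (normalCovariance L M (uvSymbolCT L M β μ (klFlowFrameU L M β U μ m) (klScale klE0 m)) + ((t : ℂ)) • (normalCovariance L M (fun ks => uvSymbolCT L M β μ (klFlowFrameU L M β U μ (m + 1)) (klScale klE0 m) ks / (1 + uvSymbolCT L M β μ (klFlowFrameU L M β U μ (m + 1)) (klScale klE0 m) ks * (((fsub (klFlowFrameU L M β U μ (m + 1)) (klFlowFrameU L M β U μ m)).eval (latticeMomentum L ks.1.2) / (β * (L : ℝ) ^ 2) : ℝ) : ℂ))) - normalCovariance L M (uvSymbolCT L M β μ (klFlowFrameU L M β U μ m) (klScale klE0 m)))) (hubbardInteraction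 L M β U + counterQuadratic L M β (klFlowFrameU L M β U μ m)) ≠ 0)
    (j : ℕ) (q : Momentum) {Np : ℝ} (hNp0 : 0 ≤ Np)
    (hNp : ∀ t ∈ Set.Icc (0 : ℝ) 1, ∀ (σ : Fin 2) (A : HubbardFieldIdx L M) (x₀ : SpaceTimeIdx L M), imagTimeWeight β M ^ 3 *
      ∑ x ∈ (univ : Finset (Fin 4 → SpaceTimeIdx L M)).filter (fun x => x 0 = x₀),
        (((((x 1).2 - (x 0).2) 0).valMinAbs.natAbs : ℝ) + ((((x 1).2 - (x 0).2) 1).valMinAbs.natAbs : ℝ)) ^ j *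
          ‖sectorisedKernel L M β (trivialMultiplier L M)
            (ExteriorAlgebra.map (LinearMap.mulLeft ℂ (fun K : HubbardFieldIdx L M => ((gnScaleCutoff 4 klE0 1 |matsubaraFreq β M K.1.1.1| : ℝ) : ℂ)))
              (effAction ℂ (normalCovariance L M (uvSymbolCT L M β μ (klFlowFrameU L M β U μ m) (klScale klE0 m)) + ((t : ℂ)) • (normalCovariance L M (fun ks => uvSymbolCT L M β μ (klFlowFrameU L M β U μ (m + 1)) (klScale klE0 m) ks / (1 + uvSymbolCT L M β μ (klFlowFrameU L M β U μ (m + 1)) (klScale klE0 m) ks * (((fsub (klFlowFrameU L M β U μ (m + 1)) (klFlowFrameU L M β U μ m)).eval (latticeMomentum L ks.1.2) / (β * (L : ℝ) ^ 2) : ℝ) : ℂ))) - normalCovariance L M (uvSymbolCT L M β μ (klFlowFrameU L M β U μ m) (klScale klE0 m)))) (hubbardInteraction L M β U + counterQuadratic L M β (klFlowFrameU L M β U μ m)))) 4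
            (![((0, σ), 0), ((0, σ), 1), ((0, A.1.2), 1 - A.2), ((0, A.1.2), A.2)] : Fin 4 → SectorLeg 1) x‖ ≤ Np)
    (hq₂ : (Real.pi / β) ^ 2 + frameLevel μ (klFlowFrameU L M β U μ (m + 1)) q ^ 2 < (klScale klE0 m) ^ 2 / 4) (hq₁ : (Real.pi / β) ^ 2 + frameLevel μ (klFlowFrameU L M β U μ m) q ^ 2 < (klScale klE0 m) ^ 2 / 4)
    {s : ℕ} (hs : 30 ≤ s) (hj : j ≤ 4) {Spj Sps SEj SEs Nj Ns Nj' Ns' : ℝ}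
    (hSp : ∀ t ∈ Set.Icc (0 : ℝ) 1, ∀ (σ : Fin 2) (x₀ : SpaceTimeIdx L M),
      (imagTimeWeight β M * ∑ x ∈ (univ : Finset (Fin 2 → SpaceTimeIdx L M)).filter (fun x => x 0 = x₀),
        (1 + ((((x 1).2 - (x 0).2) 0).valMinAbs.natAbs : ℝ) + ((((x 1).2 - (x 0).2) 1).valMinAbs.natAbs : ℝ)) ^ j *
          ‖sectorisedKernel L M β (trivialMultiplier L M)
            (effAction ℂ (normalCovariance L M (uvSymbolCT L M β μ (klFlowFrameU L M β U μ m) (klScale klE0 m)) + ((t : ℂ)) • (normalCovariance L M (fun ks => uvSymbolCT L M β μ (klFlowFrameU L M β U μ (m + 1)) (klScale klE0 m) ks / (1 + uvSymbolCT L M β μ (klFlowFrameU L M β U μ (m + 1)) (klScale klE0 m) ks * (((fsub (klFlowFrameU L M β U μ (m + 1)) (klFlowFrameU L M β U μ m)).eval (latticeMomentum L ks.1.2) / (β * (L : ℝ) ^ 2) : ℝ) : ℂ))) - normalCovariance L M (uvSymbolCT L M β μ (klFlowFrameU L M β U μ m) (klScale klE0 m)))) (hubbardInteraction L M β U + counterQuadratic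 L M β (klFlowFrameU L M β U μ m))) 2
            (![((0, σ), 0), ((0, σ), 1)] : Fin 2 → SectorLeg 1) x‖ ≤ Spj) ∧
      (imagTimeWeight β M * ∑ x ∈ (univ : Finset (Fin 2 → SpaceTimeIdx L M)).filter (fun x => x 0 = x₀),
        (1 + ((((x 1).2 - (x 0).2) 0).valMinAbs.natAbs : ℝ) + ((((x 1).2 - (x 0).2) 1).valMinAbs.natAbs : ℝ)) ^ s *
          ‖sectorisedKernel L M β (trivialMultiplier L M)
            (effAction ℂ (normalCovariance L M (uvSymbolCT L M β μ (klFlowFrameU L M β U μ m) (klScale klE0 m)) + ((t : ℂ)) • (normalCovariance L M (fun ks => uvSymbolCT L M β μ (klFlowFrameU L M β U μ (m + 1)) (klScale klE0 m) ks / (1 + uvSymbolCT L M β μ (klFlowFrameU L M β U μ (m + 1)) (klScale klE0 m) ks * (((fsub (klFlowFrameU L M β U μ (m + 1)) (klFlowFrameU L M β U μ m)).eval (latticeMomentum L ks.1.2) / (β * (L : ℝ) ^ 2) : ℝ) : ℂ))) - normalCovariance L M (uvSymbolCT L M β μ (klFlowFrameU L M β U μ m) (klScale klE0 m)))) (hubbardInteraction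 L M β U + counterQuadratic L M β (klFlowFrameU L M β U μ m))) 2
            (![((0, σ), 0), ((0, σ), 1)] : Fin 2 → SectorLeg 1) x‖ ≤ Sps))
    (hSEp : ∀ (σ : Fin 2) (x₀ : SpaceTimeIdx L M),
      (imagTimeWeight β M * ∑ x ∈ (univ : Finset (Fin 2 → SpaceTimeIdx L M)).filter (fun x => x 0 = x₀),
        (1 + ((((x 1).2 - (x 0).2) 0).valMinAbs.natAbs : ℝ) + ((((x 1).2 - (x 0).2) 1).valMinAbs.natAbs : ℝ)) ^ j *
          ‖sectorisedKernel L M β (trivialMultiplier L M)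
            (effAction ℂ (normalCovariance L M (fun ks => uvSymbolCT L M β μ (klFlowFrameU L M β U μ (m + 1)) (klScale klE0 m) ks / (1 + uvSymbolCT L M β μ (klFlowFrameU L M β U μ (m + 1)) (klScale klE0 m) ks * (((fsub (klFlowFrameU L M β U μ (m + 1)) (klFlowFrameU L M β U μ m)).eval (latticeMomentum L ks.1.2) / (β * (L : ℝ) ^ 2) : ℝ) : ℂ)))) (hubbardInteraction L M β U + counterQuadratic L M β (klFlowFrameU L M β U μ m))) 2
            (![((0, σ), 0), ((0, σ), 1)] : Fin 2 → SectorLeg 1) x‖ ≤ SEj) ∧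
      (imagTimeWeight β M * ∑ x ∈ (univ : Finset (Fin 2 → SpaceTimeIdx L M)).filter (fun x => x 0 = x₀),
        (1 + ((((x 1).2 - (x 0).2) 0).valMinAbs.natAbs : ℝ) + ((((x 1).2 - (x 0).2) 1).valMinAbs.natAbs : ℝ)) ^ s *
          ‖sectorisedKernel L M β (trivialMultiplier L M)
            (effAction ℂ (normalCovariance L M (fun ks => uvSymbolCT L M β μ (klFlowFrameU L M β U μ (m + 1)) (klScale klE0 m) ks / (1 + uvSymbolCT L M β μ (klFlowFrameU L M β U μ (m + 1)) (klScale klE0 m) ks * (((fsub (klFlowFrameU L M β U μ (m + 1)) (klFlowFrameU L M β U μ m)).eval (latticeMomentum L ks.1.2) / (β * (L : ℝ) ^ 2) : ℝ) : ℂ)))) (hubbardInteraction L M β U + counterQuadratic L M β (klFlowFrameU L M β U μ m))) 2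
            (![((0, σ), 0), ((0, σ), 1)] : Fin 2 → SectorLeg 1) x‖ ≤ SEs))
    -- the flow history and the envelope parameters (the cutoff tables are now numerals)
    {n : ℕ} (hP : ∀ m' ≤ n, FlowPieceJetsAt L M β U μ R m') (hTJ : ∀ m' ≤ n, TwoLegReadJetsF L M G Q β U μ m') (hmn : m ≤ n)
    (hR0 : 0 < R.Gfr 0) {W Ξ Θ : ℝ} (hW : W = curveExtC (8 * 576 * (342 : ℝ) ^ 4) G.S 1 + curveExtC (8 * 576 * (342 : ℝ) ^ 4) Q.S' 1 * |U|)
    (hΞ : Ξ = (2 ^ 10 * (1 + Real.pi ^ 8 * (W * U ^ 2) / 2 ^ 11) + ∑ j ∈ range 5, R.Gfr j))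
    (hΘ : Θ = (1 + ((∑ j ∈ range 5, R.Gfr j) + Real.pi ^ 8 * W / 2 ^ 11) * |U| / R.Gfr 0))
    (hdoor : R.Gfr 0 * |U| + ((∑ j ∈ range 5, R.Gfr j) + Real.pi ^ 8 * W / 2 ^ 11) * U ^ 2 ≤ 1 / 128) {P : SplitConsts} (hL : klEngL₄ P R β U ≤ L) (hmβ : m ≤ nScales β + 1)
    (hNj : Spj ≤ Nj) (hNs : Sps ≤ Ns * ((4 : ℝ) ^ m) ^ s) (hNj' : 2 * SEj ≤ Nj') (hNs' : 2 * SEs ≤ Ns' * ((4 : ℝ) ^ m) ^ s) :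
    ‖iteratedFDeriv ℝ j (evalM (symInterp L (fun kv : TorusSite 2 L =>
        klLocSelfEnergyRe L M β U μ (klFlowFrameU L M β U μ (m + 1)) m kv - klLocSelfEnergyRe L M β U μ (klFlowFrameU L M β U μ m) m kv - (fsub (klFlowFrameU L M β U μ (m + 1)) (klFlowFrameU L M β U μ m)).eval (latticeMomentum L kv)))) q‖ ≤
      2 * (2 * (|β| * (L : ℝ) ^ 2) * (12 * (2 * ((klScale klE0 m) * β / Real.pi + 3) * ((1793 * (klScale klE0 m) * (L : ℝ) ^ 2 + 704 * L) + (1793 * (klScale klE0 m) * (L : ℝ) ^ 2 + 704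
        * L)) * (β * (L : ℝ) ^ 2 * (200 + 200 * 4) / (klScale klE0 m) ^ 2 * fd)) * (Np / (β * (L : ℝ) ^ 2) ^ 3))) +
      ((2 ^ 29 * (4 : ℝ) ^ m * Nj ^ 2 + 2 ^ 12 + 2 ^ 23 * Nj') * (Real.sqrt (klEngRsq R) ^ 8 * U ^ 30 / (2 ^ 218 * β ^ 14)) + (2 ^ 26 * (4 : ℝ) ^ m * Ns ^ 2 + 2 ^ 9 + 2 ^ 20 * Ns') * (U
        / (2 ^ 59 * klEngPsq P ^ 2 * klEngRsq R ^ 2 * β ^ 3)) ^ 4) := by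
  have hβ0 : 0 < β := KLRegimeSplit.pos_of_klBetaMin_le hβmin
  have hL0 : (0 : ℝ) < (L : ℝ) := by exact_mod_cast Nat.pos_of_ne_zero (NeZero.ne L)
  have hc0 : 0 < β * (L : ℝ) ^ 2 := by positivity
  -- the tower input `N` from the four-leg position norms (p2 g12 `…kernel_four_le`)
  have hN : ∀ t ∈ Set.Icc (0 : ℝ) 1, ∀ i ∈ ({omega0 M, (omega0 M).rev} : Finset (MatsubaraIdx M)), ∀ σ : Fin 2, ∀ Al : HubbardFieldIdx L M,
      |matsubaraFreq β M Al.1.1.1| < (klScale klE0 m) →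
      (|nambuXiCT L μ (klFlowFrameU L M β U μ m) Al.1.1.2| < (klScale klE0 m) ∨ |nambuXiCT L μ (klFlowFrameU L M β U μ (m + 1)) Al.1.1.2| < (klScale klE0 m)) →
      ∑ x : TorusSite 2 L, (((x 0).valMinAbs.natAbs : ℝ) + ((x 1).valMinAbs.natAbs : ℝ)) ^ j * ‖torusFourierInv (fun kv : TorusSite 2 L =>
        kernel ℂ (effAction ℂ (normalCovariance L M (uvSymbolCT L M β μ (klFlowFrameU L M β U μ m) (klScale klE0 m)) + ((t : ℂ)) • (normalCovariance L M (fun ks => uvSymbolCT L M β μ (klFlowFrameU L M β U μ (m + 1)) (klScale klE0 m) ks / (1 + uvSymbolCT L M β μ (klFlowFrameU L M β U μ (m + 1)) (klScale klE0 m) ks * (((fsub (klFlowFrameU L M β U μ (m + 1)) (klFlowFrameU L M β U μ m)).eval (latticeMomentum L ks.1.2) / (β * (L : ℝ) ^ 2) : ℝ) : ℂ))) - normalCovariance L M (uvSymbolCT L M β μ (klFlowFrameU L M β U μ m) (klScale klE0 m)))) (hubbardInteraction L M β U + counterQuadratic L M β (klFlowFrameU L M β U μ m))) 4 (Fin.snoc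 (Fin.snoc ![((((i, kv), σ), 0) : HubbardFieldIdx L M), (((i, kv), σ), 1)] (Al.1, 1 - Al.2) : Fin 3 → HubbardFieldIdx L M) Al)) x‖ ≤
        Np / (β * (L : ℝ) ^ 2) ^ 3 :=
    fun t ht i hi σ Al hAl _ => by
      have hker : (fun kv : TorusSite 2 L => kernel ℂ (effAction ℂ (normalCovariance L M (uvSymbolCT L M β μ (klFlowFrameU L M β U μ m) (klScale klE0 m)) + ((t : ℂ)) • (normalCovariance L M (fun ks => uvSymbolCT L M β μ (klFlowFrameU L M β U μ (m + 1)) (klScale klE0 m) ks / (1 + uvSymbolCT L M β μ (klFlowFrameU L M β U μ (m + 1)) (klScale klE0 m) ks * (((fsub (klFlowFrameU L M β U μ (m + 1)) (klFlowFrameU L M β U μ m)).eval (latticeMomentum L ks.1.2) / (β * (L : ℝ) ^ 2) : ℝ) : ℂ))) - normalCovariance L M (uvSymbolCT L M β μ (klFlowFrameU L M β U μ m) (klScale klE0 m)))) (hubbardInteraction L M β U + counterQuadratic L M β (klFlowFrameU L M β U μ m))) 4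
            (Fin.snoc (Fin.snoc ![((((i, kv), σ), 0) : HubbardFieldIdx L M), (((i, kv), σ), 1)] (Al.1, 1 - Al.2) : Fin 3 → HubbardFieldIdx L M) Al)) =
          (fun kv : TorusSite 2 L => kernel ℂ (ExteriorAlgebra.map (LinearMap.mulLeft ℂ (fun K : HubbardFieldIdx L M => ((gnScaleCutoff 4 klE0 1 |matsubaraFreq β M K.1.1.1| : ℝ) : ℂ)))
            (effAction ℂ (normalCovariance L M (uvSymbolCT L M β μ (klFlowFrameU L M β U μ m) (klScale klE0 m)) + ((t : ℂ)) • (normalCovariance L M (fun ks => uvSymbolCT L M β μ (klFlowFrameU L M β U μ (m + 1)) (klScale klE0 m) ks / (1 + uvSymbolCT L M β μ (klFlowFrameU L M β U μ (m + 1)) (klScale klE0 m) ks * (((fsub (klFlowFrameU L M β U μ (m + 1)) (klFlowFrameU L M β U μ m)).eval (latticeMomentum L ks.1.2) / (β * (L : ℝ) ^ 2) : ℝ) : ℂ))) - normalCovariance L M (uvSymbolCT L M β μ (klFlowFrameU L M β U μ m) (klScale klE0 m)))) (hubbardInteraction L M β U + counterQuadratic L M β (klFlowFrameU L M β U μ m))))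 4
            (Fin.snoc (Fin.snoc ![((((i, kv), σ), 0) : HubbardFieldIdx L M), (((i, kv), σ), 1)] (Al.1, 1 - Al.2) : Fin 3 → HubbardFieldIdx L M) Al)) :=
        funext fun kv => (klbv_kernel_four_readingString_uvCut hβmin _ m hi σ hAl kv).symm
      rw [hker]
      exact TwoLegFourier.sum_weight_mul_norm_torusFourierInv_kernel_four_le hβ0 _ i σ Al
        (w := fun y : TorusSite 2 L => (((y 0).valMinAbs.natAbs : ℝ) + ((y 1).valMinAbs.natAbs : ℝ)) ^ j) (fun z => by positivity) (hNp t ht σ Al)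
  -- the two-leg rows from position space
  have hRmom : ∀ t ∈ Set.Icc (0 : ℝ) 1, ∀ i ∈ ({omega0 M, (omega0 M).rev} : Finset (MatsubaraIdx M)), ∀ σ : Fin 2,
      (∑ x : TorusSite 2 L, (1 + ((x 0).valMinAbs.natAbs : ℝ) + ((x 1).valMinAbs.natAbs : ℝ)) ^ j * ‖torusFourierInv (fun kv : TorusSite 2 L =>
        kernel ℂ (effAction ℂ (normalCovariance L M (uvSymbolCT L M β μ (klFlowFrameU L M β U μ m) (klScale klE0 m)) + ((t : ℂ)) • (normalCovariance L M (fun ks => uvSymbolCT L M β μ (klFlowFrameU L M β U μ (m + 1)) (klScale klE0 m) ks / (1 + uvSymbolCT L M β μ (klFlowFrameU L M β U μ (m + 1)) (klScale klE0 m) ks * (((fsub (klFlowFrameU L M β U μ (m + 1)) (klFlowFrameU L M β U μ m)).eval (latticeMomentum L ks.1.2) / (β * (L : ℝ) ^ 2) : ℝ) : ℂ))) - normalCovariance L M (uvSymbolCT L M β μ (klFlowFrameU L M β U μ m) (klScale klE0 m)))) (hubbardInteraction L M β U + counterQuadratic L M β (klFlowFrameU L M β U μ m))) 2 ![((((i,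 kv), σ), 0) : HubbardFieldIdx L M), (((i, kv), σ), 1)]) x‖ ≤ Spj / (β * (L : ℝ) ^ 2)) ∧
      (∑ x : TorusSite 2 L, (1 + ((x 0).valMinAbs.natAbs : ℝ) + ((x 1).valMinAbs.natAbs : ℝ)) ^ s * ‖torusFourierInv (fun kv : TorusSite 2 L =>
        kernel ℂ (effAction ℂ (normalCovariance L M (uvSymbolCT L M β μ (klFlowFrameU L M β U μ m) (klScale klE0 m)) + ((t : ℂ)) • (normalCovariance L M (fun ks => uvSymbolCT L M β μ (klFlowFrameU L M β U μ (m + 1)) (klScale klE0 m) ks / (1 + uvSymbolCT L M β μ (klFlowFrameU L M β U μ (m + 1)) (klScale klE0 m) ks * (((fsub (klFlowFrameU L M β U μ (m + 1)) (klFlowFrameU L M β U μ m)).eval (latticeMomentum L ks.1.2) / (β * (L : ℝ) ^ 2) : ℝ) : ℂ))) - normalCovariance L M (uvSymbolCT L M β μ (klFlowFrameU L M β U μ m) (klScale klE0 m)))) (hubbardInteraction L M β U + counterQuadratic L M β (klFlowFrameU L M β U μ m))) 2 ![((((i, kv), σ), 0) : HubbardFieldIdx L M), (((i, kv), σ), 1)])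 x‖ ≤ Sps / (β * (L : ℝ) ^ 2)) :=
    fun t ht i _ σ =>
      ⟨TwoLegFourier.sum_weight_mul_norm_torusFourierInv_kernel_two_le hβ0 _ i σ (w := fun y : TorusSite 2 L => (1 + ((y 0).valMinAbs.natAbs : ℝ) + ((y 1).valMinAbs.natAbs : ℝ)) ^ j) (fun z => by positivity)
          (fun x₀ => (hSp t ht σ x₀).1),
        TwoLegFourier.sum_weight_mul_norm_torusFourierInv_kernel_two_le hβ0 _ i σ (w := fun y : TorusSite 2 L => (1 + ((y 0).valMinAbs.natAbs : ℝ) + ((y 1).valMinAbs.natAbs : ℝ)) ^ s) (fun z => by positivity)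
          (fun x₀ => (hSp t ht σ x₀).2)⟩
  have hSE : ∀ i ∈ ({omega0 M, (omega0 M).rev} : Finset (MatsubaraIdx M)), ∀ σ : Fin 2,
      (∑ x : TorusSite 2 L, (1 + ((x 0).valMinAbs.natAbs : ℝ) + ((x 1).valMinAbs.natAbs : ℝ)) ^ j * ‖torusFourierInv (fun kv : TorusSite 2 L =>
        selfEnergy L M β (effAction ℂ (normalCovariance L M (fun ks => uvSymbolCT L M β μ (klFlowFrameU L M β U μ (m + 1)) (klScale klE0 m) ks / (1 + uvSymbolCT L M β μ (klFlowFrameU L M β U μ (m + 1)) (klScale klE0 m) ks * (((fsub (klFlowFrameU L M β U μ (m + 1)) (klFlowFrameU L M β U μ m)).eval (latticeMomentum L ks.1.2) / (β * (L : ℝ) ^ 2) : ℝ) : ℂ)))) (hubbardInteraction L M β U + counterQuadratic L M β (klFlowFrameU L M β U μ m))) (i, kv) σ) x‖ ≤ 2 * SEj) ∧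
      (∑ x : TorusSite 2 L, (1 + ((x 0).valMinAbs.natAbs : ℝ) + ((x 1).valMinAbs.natAbs : ℝ)) ^ s * ‖torusFourierInv (fun kv : TorusSite 2 L =>
        selfEnergy L M β (effAction ℂ (normalCovariance L M (fun ks => uvSymbolCT L M β μ (klFlowFrameU L M β U μ (m + 1)) (klScale klE0 m) ks / (1 + uvSymbolCT L M β μ (klFlowFrameU L M β U μ (m + 1)) (klScale klE0 m) ks * (((fsub (klFlowFrameU L M β U μ (m + 1)) (klFlowFrameU L M β U μ m)).eval (latticeMomentum L ks.1.2) / (β * (L : ℝ) ^ 2) : ℝ) : ℂ)))) (hubbardInteraction L M β U + counterQuadratic L M β (klFlowFrameU L M β U μ m))) (i, kv) σ) x‖ ≤ 2 * SEs) :=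
    fun i _ σ =>
      ⟨TwoLegFourier.sum_momentWeight_norm_torusFourierInv_selfEnergy_le hβ0 _ i σ j (fun x₀ => (hSEp σ x₀).1),
        TwoLegFourier.sum_momentWeight_norm_torusFourierInv_selfEnergy_le hβ0 _ i σ s (fun x₀ => (hSEp σ x₀).2)⟩
  -- the envelopes in the door's currency (`|β|·L²·(Sp/(βL²)) = Sp`)
  have e2 : ∀ X : ℝ, |β| * (L : ℝ) ^ 2 * (X / (β * (L : ℝ) ^ 2)) = X := fun X => by
    rw [abs_of_pos hβ0]; field_simp
  have hNj_d : |β| * (L : ℝ) ^ 2 * (Spj / (β * (L : ℝ) ^ 2)) ≤ Nj := by rw [e2]; exact hNj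
  have hNs_d : |β| * (L : ℝ) ^ 2 * (Sps / (β * (L : ℝ) ^ 2)) ≤ Ns * ((4 : ℝ) ^ m) ^ s := by rw [e2]; exact hNs
  exact norm_iteratedFDeriv_klLocSelfEnergyRe_flowFrame_sub_le_main_add_alias_graded_pure hβmin hU hU1 μ m hRG hGS hQS hμ hOK₁ hOK₂ hfdist hfd hZ₂ hZ j q
    (div_nonneg hNp0 (pow_nonneg hc0.le 3)) hN hq₂ hq₁ hs hj hRmom hSE hP hTJ hmn hR0 hW hΞ hΘ hdoor hL hmβ hNj_d hNs_d hNj' hNs'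

end MainAliasPos

end Summit.HubbardSuperconductivity.HubbardSuperconductivity.Theorems.EngineV8

end
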